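import Literature.NumberTheory.Automorphic.BrandtMatrixThetaSeries
import Literature.NumberTheory.Automorphic.BrandtThetaSeriesClassFunction
import Literature.NumberTheory.ModularForms.SiegelThetaMultiplierGaussSum
import Literature.NumberTheory.ModularForms.SiegelThetaMultiplierCyclotomic
import Literature.NumberTheory.EllipticCurves.ModularFormsGamma0Genus
import Mathlib.NumberTheory.ModularForms.CuspFormSubmodule
import HarnessLib

/-!
# Stub-ideas k=1 · GEN 8 · `stub_xiDegreeComparison` (crux `SteinbergCore`, line `p6_tamagawa_split`)

Family 1 RECOGNISE & IMPORT, k=1's job in the converged k1+k2+k3 chain: supply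
H1 = `∀ i j k l, IsCuspForm (Θ_ij − Θ_kl)` for a Brandt setup `S : XiSetup N⁺ N⁻`.

GEN-8 DELTA (this file, `lean check` rc 0, **0 sorries**): the analytic spine E1 → E1b → E1′ of the gen-5/6
blueprint — the one M-sized helper every previous generation left as "E1 (M): to type" — is now PROVED against
the tree's Andrianov–Zhuravlev API along the cusp path `t ↦ S·(it) = i/t`, `M = spOfSL (γ·S)`:

* §0  dictionary (`brandtGram`, `thetaCuspValue` verbatim as gen 5/6) + proved facts the E-block consumes:
      `brandtGram` is symmetric, even, positive definite, `det = N²`, and has a LEVEL DATUM `P·[T] = [T]·P = N·1`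
      (tree `XiSetup.exists_normFormGram_levelDatum`); blocks / `det D = −c` / `|c|·BD⁻¹ = (a·sign c)` /
      `BD⁻¹ = (a/c)` of `spOfSL (γ·S)`; `det(C·it + D) = c_δ it + d_δ`;
* E1  (PROVED) `(Θ_ij ∣₂ γ)(S·it) = −(√det[T]_ℝ)⁻¹ c⁻² Σ_{L mod |c|} e{[T][L]·a/c} · Θ_P(0; Z′_t, W_L)` —
      `siegelThetaSeries_moeb_I_smul_eq_sum` (A–Z (4.13)–(4.14)) at `n = 1`, `M = spOfSL (γ·S)`, `d = |c|`, times
      the slash factor `denom(γ, i/t)^{−2}`; the scalar identity `cuspPath_scalar` (`(d_γ it − c) = it·x`, `I² = −1`);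
* E1b (PROVED) the limit `t → 0⁺` is `thetaCuspValue [T] γ`: each `Θ_P(Z′_t, W_L) → 1`
      (`tendsto_siegelJacobiTheta_zPrime`, `P` symmetric & `> 0` from the level datum), `tendsto_finsetSum`,
      `Σ_L e{…} = |c|⁴ G(a/c,[T])` (`siegelGaussSum_def`), `det([T].map ℝ) = (det[T] : ℝ)` (`RingHom.map_det`);
* E1c (c = 0, PROVED) and **E1′ (PROVED)**: `valueAtInfty (Θ_ij ∣₂ γ) = thetaCuspValue [T_ij] γ` for EVERY
      `γ ∈ SL₂(ℤ)` (limit uniqueness along the path; `tendsto_cosetSlash`; path lemma `S·it → i∞`).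

ALSO PROVED HERE (§F–§J): C3b `siegelGaussSum_congr_num` (numerator congruence), E2′ `siegelGaussSum_conj`
(exact-conjugation invariance `G_d(S', Uᵀ Q U) = G_d(S', Q)` for `U` invertible mod `d`, `d S'` integral — by the
`(ℤ/d)`-reindexing `X ↦ Ū X` and `siegelThetaSeriesTerm_add_smul`), C3a (copied from gen 6), **C4**
`exists_thetaCuspValue_brandtGram_eq_sameRow_of` (assembled from B5 + C1 as hypotheses: `γ' = (na, −v; c, u)`,
`G(a/c,[T_ij]) = G(a/c,[T_ij][U]) = G(a/c, n[T_il]) = G(na/c,[T_il])`), L1 + C2 (copied), **C1**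
`c1Statement_holds` / `exists_gamma0_mul_T_zpow` (`δ_h = γ' T^{-h} γ⁻¹`, `g = (c, N/(N,c)) ∣ d − d'`, Bézout), and
the compositions `brandtTheta_sub_isCuspForm_of` / **`brandtTheta_sub_isCuspForm_of_B5`**:

  H1 (`∀ i j k l, IsCuspForm (Θ_ij − Θ_kl)`) ⟸ `∀ i j l, B5Statement S i j l` — KERNEL-CHECKED, 0 sorries.

CONSEQUENCE: of the gen-6 blueprint ONLY the arithmetic sublattice datum B5 (`exists_brandtGram_sublattice_datum`,
size M; sub-helpers B1, B3, B4 open, B2 proved gen 7, B0 only to discharge `hcop`) remains between the tree and H1.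
Plan A (cite H1 as a named fact) gained a level-agnostic GENUS citation: Hanke, Duke Math. J. 124 (2004) §4
(4.3),(4.5) pp. 365–366 (θ_Q = E + cusp form for n ≥ 4, a_E = Siegel's weighted genus average, citing Siegel 1935
[S] and Schulze-Pillot 1984 [SP2, Satz 2]) and Kitaoka, *Arithmetic of Quadratic Forms* (CUP 1993), Notes to Ch. 6
(θ(z,S) minus the genus average is a cusp form if m = 1).  Evidence / plan file of stub-ideation k=1 (gen 8); not a
proposal.
-/

noncomputable section

open Complex hiding I
open Matrix Filter Topology ModularForm
open Complex (I)
open scoped MatrixGroups UpperHalfPlane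

namespace Summit.ABC.ABC.Cruxes.SteinbergCore.StubIdeasK1G8

open Literature.NumberTheory.ModularForms
open Literature.NumberTheory.ModularForms.SiegelModularForm (one1 one1_map one1_mul one1_inv smul_one1 det_one1
  one1_injective eq_one1 spOfSL spOfSL_mem moeb_spOfSL det_denom_spOfSL num_denom_spOfSL)
open Literature.NumberTheory.EllipticCurves.ModularForms
open Literature.NumberTheory.Automorphic Literature.NumberTheory.Automorphic.Brandt

/-! ## §0 Dictionary (gen 5/6) and the facts about `[T_ij]` the E-block consumes -/

variable {Nplus Nminus : ℕ} (S : XiSetup Nplus Nminus)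

/-- The Gram matrix `[T_{ij}]` behind `S.brandtTheta i j`. -/
def brandtGram (i j : ClassSet S.O) : Matrix (Fin 4) (Fin 4) ℤ :=
  normFormGram (S.nonempty_basis_transporterLeft i.rep_mem j.rep_mem).some (S.nrdGen j.rep_mem / S.nrdGen i.rep_mem)

theorem brandtTheta_apply (i j : ClassSet S.O) (τ : ℍ) :
    S.brandtTheta i j τ = siegelThetaSeries (brandtGram S i j) (one1 (τ : ℂ)) := rfl

/-- The Gram identity `⌊trd(b_r b̄_s)/q⌋ · q = trd(b_r b̄_s)` for the basis behind `brandtGram`. -/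
theorem cast_brandtGram_mul (i j : ClassSet S.O) (r s : Fin 4) :
    ((brandtGram S i j r s : ℤ) : ℚ) * (S.nrdGen j.rep_mem / S.nrdGen i.rep_mem) =
      reducedTrace ℚ S.D (((S.nonempty_basis_transporterLeft i.rep_mem j.rep_mem).some r : S.D) *
        standardInvolution ℚ S.D ((S.nonempty_basis_transporterLeft i.rep_mem j.rep_mem).some s : S.D)) :=
  (S.ofLeftOrder i.rep_mem).cast_normFormGram_mul (div_pos (S.nrdGen_pos j.rep_mem) (S.nrdGen_pos i.rep_mem)).ne'
    (S.nrdIdeal_transporterLeft j.rep_mem i.rep_mem (S.nrdGen_pos j.rep_mem) (S.nrdGen_pos i.rep_mem)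
      (S.nrdIdeal_eq_span_nrdGen j.rep_mem) (S.nrdIdeal_eq_span_nrdGen i.rep_mem)) _ r s

theorem det_brandtGram (i j : ClassSet S.O) : (brandtGram S i j).det = ((Nplus * Nminus : ℕ) : ℤ) ^ 2 :=
  (S.ofLeftOrder i.rep_mem).det_normFormGram (S.transporterLeft_mem_rightIdeals_leftOrder i.rep_mem j.rep_mem)
    (div_pos (S.nrdGen_pos j.rep_mem) (S.nrdGen_pos i.rep_mem))
    (S.nrdIdeal_transporterLeft j.rep_mem i.rep_mem (S.nrdGen_pos j.rep_mem) (S.nrdGen_pos i.rep_mem)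
      (S.nrdIdeal_eq_span_nrdGen j.rep_mem) (S.nrdIdeal_eq_span_nrdGen i.rep_mem)) (cast_brandtGram_mul S i j)

/-- NEW (proved). `[T_ij]` is symmetric. -/
theorem brandtGram_isSymm (i j : ClassSet S.O) : (brandtGram S i j).IsSymm :=
  isSymm_of_normFormGram (div_pos (S.nrdGen_pos j.rep_mem) (S.nrdGen_pos i.rep_mem)).ne' (cast_brandtGram_mul S i j)

/-- NEW (proved). `[T_ij]` is even. -/
theorem even_brandtGram_diag (i j : ClassSet S.O) (r : Fin 4) : Even (brandtGram S i j r r) :=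
  (S.ofLeftOrder i.rep_mem).even_normFormGram_diag (div_pos (S.nrdGen_pos j.rep_mem) (S.nrdGen_pos i.rep_mem)).ne'
    (S.nrdIdeal_transporterLeft j.rep_mem i.rep_mem (S.nrdGen_pos j.rep_mem) (S.nrdGen_pos i.rep_mem)
      (S.nrdIdeal_eq_span_nrdGen j.rep_mem) (S.nrdIdeal_eq_span_nrdGen i.rep_mem)) (cast_brandtGram_mul S i j) r

/-- NEW (proved). `[T_ij] > 0`. -/
theorem posDef_brandtGram (i j : ClassSet S.O) : ((brandtGram S i j).map ((↑) : ℤ → ℝ)).PosDef :=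
  (S.ofLeftOrder i.rep_mem).posDef_normFormGram_map (S.transporterLeft_mem_rightIdeals_leftOrder i.rep_mem j.rep_mem).1
    (div_pos (S.nrdGen_pos j.rep_mem) (S.nrdGen_pos i.rep_mem)) (cast_brandtGram_mul S i j)

/-- NEW (proved). The LEVEL DATUM of `[T_ij]`: `P·[T] = [T]·P = N⁺N⁻ · 1`, `P` even. -/
theorem exists_brandtGram_levelDatum (i j : ClassSet S.O) :
    ∃ P : Matrix (Fin 4) (Fin 4) ℤ, P * brandtGram S i j = ((Nplus * Nminus : ℕ) : ℤ) • (1 : Matrix (Fin 4) (Fin 4) ℤ) ∧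
      brandtGram S i j * P = ((Nplus * Nminus : ℕ) : ℤ) • (1 : Matrix (Fin 4) (Fin 4) ℤ) ∧ ∀ r, Even (P r r) :=
  (S.ofLeftOrder i.rep_mem).exists_normFormGram_levelDatum (S.transporterLeft_mem_rightIdeals_leftOrder i.rep_mem j.rep_mem)
    (div_pos (S.nrdGen_pos j.rep_mem) (S.nrdGen_pos i.rep_mem))
    (S.nrdIdeal_transporterLeft j.rep_mem i.rep_mem (S.nrdGen_pos j.rep_mem) (S.nrdGen_pos i.rep_mem)
      (S.nrdIdeal_eq_span_nrdGen j.rep_mem) (S.nrdIdeal_eq_span_nrdGen i.rep_mem)) (cast_brandtGram_mul S i j)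

/-- Cusp constant of `θ_Q ∣ γ` (gen 5, verbatim): `d^{m/2}` at `c = 0`, else `(√det Q)⁻¹ (ic)^{−m/2} |c|^m G(a/c, Q)`. -/
def thetaCuspValue {m : ℕ} (Q : Matrix (Fin m) (Fin m) ℤ) (γ : SL(2, ℤ)) : ℂ :=
  if γ 1 0 = 0 then ((γ 1 1 : ℤ) : ℂ) ^ (m / 2)
  else ((Real.sqrt ((Q.det : ℤ) : ℝ) : ℝ) : ℂ)⁻¹ * (I * ((γ 1 0 : ℤ) : ℂ)) ^ (-((m / 2 : ℕ) : ℤ)) *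
      (((γ 1 0).natAbs : ℕ) : ℂ) ^ m *
        siegelGaussSum Q (γ 1 0).natAbs (one1 (((γ 0 0 : ℤ) : ℂ) / ((γ 1 0 : ℤ) : ℂ)))

/-! ## §E0 The symplectic matrix `M = spOfSL (γ·S)` of the cusp path (all PROVED) -/

/-- Entries of `γ·S = (b, −a; d, −c)`. -/
theorem mul_S_apply (γ : SL(2, ℤ)) :
    (γ * ModularGroup.S) 0 0 = γ 0 1 ∧ (γ * ModularGroup.S) 0 1 = -(γ 0 0) ∧
      (γ * ModularGroup.S) 1 0 = γ 1 1 ∧ (γ * ModularGroup.S) 1 1 = -(γ 1 0) := by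
  refine ⟨?_, ?_, ?_, ?_⟩ <;>
    simp [Matrix.SpecialLinearGroup.coe_mul, ModularGroup.coe_S, Matrix.mul_apply, Fin.sum_univ_two]

/-- Blocks of `M = spOfSL (γ·S)`: `B = (−a)`, `C = (d)`, `D = (−c)`. -/
theorem toBlocks_spOfSL_mul_S (γ : SL(2, ℤ)) :
    (spOfSL (γ * ModularGroup.S)).toBlocks₁₂ = one1 (-(γ 0 0)) ∧ (spOfSL (γ * ModularGroup.S)).toBlocks₂₁ = one1 (γ 1 1) ∧
      (spOfSL (γ * ModularGroup.S)).toBlocks₂₂ = one1 (-(γ 1 0)) := by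
  obtain ⟨-, h01, h10, h11⟩ := mul_S_apply γ
  refine ⟨?_, ?_, ?_⟩
  · rw [spOfSL, Matrix.toBlocks_fromBlocks₁₂, h01]
  · rw [spOfSL, Matrix.toBlocks_fromBlocks₂₁, h10]
  · rw [spOfSL, Matrix.toBlocks_fromBlocks₂₂, h11]

/-- `det D = −c ≠ 0` off the cusp `∞`. -/
theorem det_toBlocks₂₂_spOfSL_mul_S (γ : SL(2, ℤ)) : (spOfSL (γ * ModularGroup.S)).toBlocks₂₂.det = -(γ 1 0) := by
  rw [(toBlocks_spOfSL_mul_S γ).2.2, det_one1]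

/-- `d·BD⁻¹ = (a·sign c)` is integral for `d = |c|`. -/
theorem natAbs_smul_B_mul_inv_D (γ : SL(2, ℤ)) (hc : γ 1 0 ≠ 0) :
    (((γ 1 0).natAbs : ℕ) : ℂ) • ((spOfSL (γ * ModularGroup.S)).toBlocks₁₂.map ((↑) : ℤ → ℂ) *
        ((spOfSL (γ * ModularGroup.S)).toBlocks₂₂.map ((↑) : ℤ → ℂ))⁻¹) =
      (one1 (γ 0 0 * Int.sign (γ 1 0))).map ((↑) : ℤ → ℂ) := by
  obtain ⟨h12, -, h22⟩ := toBlocks_spOfSL_mul_S γ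
  have hc' : ((-(γ 1 0) : ℤ) : ℂ) ≠ 0 := by exact_mod_cast (neg_ne_zero.2 hc)
  rw [h12, h22, one1_map, one1_map, one1_inv hc', one1_mul, smul_one1, one1_map]
  congr 1
  have habs : (((γ 1 0).natAbs : ℕ) : ℂ) = ((Int.sign (γ 1 0) * γ 1 0 : ℤ) : ℂ) := by
    rw [Int.sign_mul_self_eq_natAbs, Int.cast_natCast]
  have hc0 : ((γ 1 0 : ℤ) : ℂ) ≠ 0 := by exact_mod_cast hc
  rw [habs]
  push_cast
  field_simp

/-- `BD⁻¹ = (a/c)` for `M = spOfSL (γ·S)`. -/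
theorem B_mul_inv_D_eq (γ : SL(2, ℤ)) (hc : γ 1 0 ≠ 0) :
    (spOfSL (γ * ModularGroup.S)).toBlocks₁₂.map ((↑) : ℤ → ℂ) * ((spOfSL (γ * ModularGroup.S)).toBlocks₂₂.map ((↑) : ℤ → ℂ))⁻¹ =
      one1 (((γ 0 0 : ℤ) : ℂ) / ((γ 1 0 : ℤ) : ℂ)) := by
  obtain ⟨h12, -, h22⟩ := toBlocks_spOfSL_mul_S γ
  have hc' : ((-(γ 1 0) : ℤ) : ℂ) ≠ 0 := by exact_mod_cast (neg_ne_zero.2 hc)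
  rw [h12, h22, one1_map, one1_map, one1_inv hc', one1_mul]
  congr 1
  push_cast
  rw [neg_mul, inv_neg, mul_neg, neg_neg, div_eq_mul_inv]

/-- The cusp path in Siegel coordinates: `M⟨it·1⟩ = ((γ·S)·(it)) = (γ·(i/t))`. -/
theorem moeb_spOfSL_mul_S_I_smul (γ : SL(2, ℤ)) {t : ℝ} (ht : 0 < t) :
    SiegelUpperHalfSpace.moeb ((spOfSL (γ * ModularGroup.S)).map ((↑) : ℤ → ℂ)) ((I * (t : ℂ)) • (1 : Matrix (Fin 1) (Fin 1) ℂ)) =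
      one1 (((γ • (ModularGroup.S • UpperHalfPlane.ofComplex (I * t)) : ℍ) : ℂ)) := by
  have hIm : 0 < (I * t : ℂ).im := by simp [ht]
  have h1 : (I * (t : ℂ)) • (1 : Matrix (Fin 1) (Fin 1) ℂ) = one1 (((UpperHalfPlane.ofComplex (I * t) : ℍ) : ℂ)) := by
    rw [UpperHalfPlane.ofComplex_apply_of_im_pos hIm, ← SiegelModularForm.one1_one, smul_one1, mul_one]
  rw [h1, moeb_spOfSL, mul_smul]

/-- `det(C·(it) + D) = c_δ·it + d_δ` for `M = spOfSL δ` at `Z = it·1`. -/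
theorem det_denom_spOfSL_I_smul (δ : SL(2, ℤ)) {t : ℝ} (ht : 0 < t) :
    (SiegelUpperHalfSpace.denom ((spOfSL δ).map ((↑) : ℤ → ℂ)) ((I * (t : ℂ)) • (1 : Matrix (Fin 1) (Fin 1) ℂ))).det =
      ((δ 1 0 : ℤ) : ℂ) * (I * t) + ((δ 1 1 : ℤ) : ℂ) := by
  have hIm : 0 < (I * t : ℂ).im := by simp [ht]
  have h1 : (I * (t : ℂ)) • (1 : Matrix (Fin 1) (Fin 1) ℂ) = one1 (((UpperHalfPlane.ofComplex (I * t) : ℍ) : ℂ)) := by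
    rw [UpperHalfPlane.ofComplex_apply_of_im_pos hIm, ← SiegelModularForm.one1_one, smul_one1, mul_one]
  rw [h1, det_denom_spOfSL, ModularGroup.denom_apply, UpperHalfPlane.ofComplex_apply_of_im_pos hIm]

/-- The path `t ↦ S·(it) = i/t` runs into the cusp `i∞` as `t → 0⁺`. -/
theorem tendsto_S_smul_ofComplex_I_mul :
    Tendsto (fun t : ℝ => ModularGroup.S • UpperHalfPlane.ofComplex (I * t)) (𝓝[>] 0) UpperHalfPlane.atImInfty := by
  rw [UpperHalfPlane.atImInfty, Filter.tendsto_comap_iff]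
  refine tendsto_inv_nhdsGT_zero.congr' (eventually_nhdsWithin_of_forall fun t (ht : 0 < t) => ?_)
  have hIm : 0 < (I * t : ℂ).im := by simp [ht]
  rw [Function.comp_apply, UpperHalfPlane.modular_S_smul, UpperHalfPlane.im, UpperHalfPlane.coe_mk,
    UpperHalfPlane.ofComplex_apply_of_im_pos hIm]
  simp [Complex.inv_im, Complex.normSq_apply]

/-- The scalar identity behind E1: `t²(ci + d t)^{−2} · (t⁻¹ c⁻² (d·it − c)(−c))² = −c⁻²` (through
`d·it − c = it·(c(−it)⁻¹ + d)` and `I² = −1`). PROVED. -/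
theorem cuspPath_scalar (s c d t : ℂ) (hs : s ≠ 0) (hc : c ≠ 0) (ht : t ≠ 0) (hx : c * (-(I * t))⁻¹ + d ≠ 0) :
    s⁻¹ * (t⁻¹ * (c ^ 2)⁻¹ * (d * (I * t) + -c) * -c) ^ 2 * ((c * (-(I * t))⁻¹ + d) ^ 2)⁻¹ = -(s⁻¹ * (c ^ 2)⁻¹) := by
  have hIt : -(I * t) ≠ 0 := neg_ne_zero.2 (mul_ne_zero I_ne_zero ht)
  have hy : d * (I * t) + -c = I * t * (c * (-(I * t))⁻¹ + d) := by
    field_simp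
    ring
  rw [hy]
  generalize c * (-(I * t))⁻¹ + d = x at hx ⊢
  have hI : (I * t * x) ^ 2 = -(t ^ 2 * x ^ 2) := by
    rw [mul_pow, mul_pow, I_sq]; ring
  rw [show (t⁻¹ * (c ^ 2)⁻¹ * (I * t * x) * -c) ^ 2 = (t⁻¹ * (c ^ 2)⁻¹ * -c) ^ 2 * (I * t * x) ^ 2 by ring, hI]
  field_simp

/-! ## §E The analytic spine E1 → E1b → E1′ (ALL PROVED, gen 8) -/

/-- **E1 (PROVED, gen 8).** `(Θ_ij ∣₂ γ)(S·it) = −(√det[T])⁻¹ c⁻² Σ_{L : Fin 4 → Fin |c|} e{[T][L]·a/c}·Θ_P(Z′_t, W_L)`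
for `c = γ₁₀ ≠ 0`, `t > 0`, `P` the level datum.  PROOF ROUTE: `ModularForm.SL_slash_apply`, `brandtTheta_apply`,
`moeb_spOfSL_mul_S_I_smul` (backwards) to reach `siegelThetaSeries [T] (M⟨it·1⟩)`; then
`siegelThetaSeries_moeb_I_smul_eq_sum [T] (brandtGram_isSymm) (even_brandtGram_diag) (posDef_brandtGram) ⟨2, rfl⟩ hN hPQ hQP
(spOfSL_mem _) (det_toBlocks₂₂_spOfSL_mul_S ▸ …) (Int.natAbs_pos.2 hc) (natAbs_smul_B_mul_inv_D γ hc) ht` (n = 1, so `(…)^n`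
is `(…)^1`), `B_mul_inv_D_eq` under `Finset.sum_congr`; the scalar algebra: `denom(γ, S·it) = (ci + d_γ t)/t`
(`ModularGroup.denom_apply`, `modular_S_smul`), `det (denom M (it·1)) = d_γ·it − c = i(ci + d_γ t)` (`denom_fromBlocks`,
`det_one1`), `det D = −c`, whence `t²(ci+d_γ t)^{−2} · (t⁻¹ c⁻² (d_γ it − c)(−c))² = −c⁻²` (`field_simp; ring` with `I_sq`). -/
theorem slash_brandtTheta_apply_cuspPath [NeZero (Nplus * Nminus)] (i j : ClassSet S.O) (γ : SL(2, ℤ)) (hc : γ 1 0 ≠ 0)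
    {P : Matrix (Fin 4) (Fin 4) ℤ} (hPQ : P * brandtGram S i j = ((Nplus * Nminus : ℕ) : ℤ) • (1 : Matrix (Fin 4) (Fin 4) ℤ))
    (hQP : brandtGram S i j * P = ((Nplus * Nminus : ℕ) : ℤ) • (1 : Matrix (Fin 4) (Fin 4) ℤ)) {t : ℝ} (ht : 0 < t) :
    (⇑(S.brandtTheta i j) ∣[(2 : ℤ)] (γ : GL (Fin 2) ℝ)) (ModularGroup.S • UpperHalfPlane.ofComplex (I * t)) =
      -((((Real.sqrt ((brandtGram S i j).map ((↑) : ℤ → ℝ)).det : ℝ) : ℂ))⁻¹ * (((γ 1 0 : ℤ) : ℂ) ^ 2)⁻¹) *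
        ∑ L : Matrix (Fin 4) (Fin 1) (Fin (γ 1 0).natAbs),
          siegelThetaSeriesTerm (brandtGram S i j) (one1 (((γ 0 0 : ℤ) : ℂ) / ((γ 1 0 : ℤ) : ℂ))) (L.map fun x => ((x : ℕ) : ℤ)) *
            siegelJacobiTheta P (0 : Matrix (Fin 1) (Fin 4) ℂ)
              ((((Nplus * Nminus : ℕ) : ℤ) : ℂ)⁻¹ • ((-((I * (t : ℂ))⁻¹ * ((((γ 1 0).natAbs : ℕ) : ℂ) ^ 2)⁻¹)) •
                (SiegelUpperHalfSpace.denom ((spOfSL (γ * ModularGroup.S)).map ((↑) : ℤ → ℂ))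
                    ((I * (t : ℂ)) • (1 : Matrix (Fin 1) (Fin 1) ℂ)) *
                  ((spOfSL (γ * ModularGroup.S)).toBlocks₂₂.map ((↑) : ℤ → ℂ))ᵀ)))
              ((((Nplus * Nminus : ℕ) : ℤ) : ℂ)⁻¹ •
                (((((γ 1 0).natAbs : ℕ) : ℂ))⁻¹ • ((L.map fun x => ((x : ℕ) : ℤ)).map ((↑) : ℤ → ℂ))ᵀ *
                  (brandtGram S i j).map ((↑) : ℤ → ℂ))) := by
  set Q := brandtGram S i j with hQdef
  have hQ := brandtGram_isSymm S i j
  have hQe := even_brandtGram_diag S i j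
  have hQp := posDef_brandtGram S i j
  have hN : (0 : ℤ) < ((Nplus * Nminus : ℕ) : ℤ) := by exact_mod_cast Nat.pos_of_ne_zero (NeZero.ne (Nplus * Nminus))
  have hM := spOfSL_mem (γ * ModularGroup.S)
  have hD : (spOfSL (γ * ModularGroup.S)).toBlocks₂₂.det ≠ 0 := by
    rw [det_toBlocks₂₂_spOfSL_mul_S]; exact neg_ne_zero.2 hc
  have hd : 0 < (γ 1 0).natAbs := Int.natAbs_pos.2 hc
  have hdS := natAbs_smul_B_mul_inv_D γ hc
  have hIm : 0 < (I * t : ℂ).im := by simp [ht]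
  -- the point `S·(it) = (−it)⁻¹` and the automorphy factor `c(−it)⁻¹ + d ≠ 0`
  have hcoe : ((ModularGroup.S • UpperHalfPlane.ofComplex (I * t) : ℍ) : ℂ) = (-(I * t))⁻¹ := by
    rw [UpperHalfPlane.modular_S_smul, UpperHalfPlane.coe_mk, UpperHalfPlane.ofComplex_apply_of_im_pos hIm]
  have hx := UpperHalfPlane.denom_ne_zero (γ : GL (Fin 2) ℝ) (ModularGroup.S • UpperHalfPlane.ofComplex (I * t))
  rw [ModularGroup.denom_apply, hcoe] at hx
  -- expand along (4.13)–(4.14)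
  rw [← ModularForm.SL_slash, ModularForm.SL_slash_apply, ModularGroup.denom_apply, hcoe, brandtTheta_apply, ← hQdef,
    ← moeb_spOfSL_mul_S_I_smul γ ht,
    siegelThetaSeries_moeb_I_smul_eq_sum Q hQ hQe hQp ⟨2, rfl⟩ hN hPQ hQP hM hD hd hdS ht]
  simp only [B_mul_inv_D_eq γ hc]
  rw [det_denom_spOfSL_I_smul (γ * ModularGroup.S) ht, det_toBlocks₂₂_spOfSL_mul_S, (mul_S_apply γ).2.2.1,
    (mul_S_apply γ).2.2.2]
  -- scalar algebra: `t²(ci + d_γ t)^{−2} · (t⁻¹ c⁻² (d_γ it − c)(−c))² = −c⁻²`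
  have ht0 : (t : ℂ) ≠ 0 := by exact_mod_cast ht.ne'
  have hc0 : ((γ 1 0 : ℤ) : ℂ) ≠ 0 := by exact_mod_cast hc
  have hd0 : (((γ 1 0).natAbs : ℕ) : ℂ) ≠ 0 := by exact_mod_cast hd.ne'
  have hd2 : (((γ 1 0).natAbs : ℕ) : ℂ) ^ 2 = ((γ 1 0 : ℤ) : ℂ) ^ 2 := by
    rw [← Int.cast_natCast, ← Int.cast_pow, Int.natAbs_sq, Int.cast_pow]
  have hs : ((Real.sqrt (Q.map ((↑) : ℤ → ℝ)).det : ℝ) : ℂ) ≠ 0 := by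
    exact_mod_cast (Real.sqrt_pos.2 hQp.det_pos).ne'
  have hIt : (-(I * (t : ℂ))) ≠ 0 := neg_ne_zero.2 (mul_ne_zero I_ne_zero ht0)
  rw [show (4 / 2 : ℕ) = 2 from rfl, _root_.zpow_neg, zpow_ofNat, mul_right_comm]
  congr 1
  simp only [pow_one]
  push_cast
  rw [hd2]
  linear_combination cuspPath_scalar _ _ ((γ 1 1 : ℤ) : ℂ) _ hs hc0 ht0 hx

/-- **E1b (PROVED, gen 8).** The limit along the path is the gen-5 cusp constant:
`(Θ_ij ∣₂ γ)(S·it) → thetaCuspValue [T_ij] γ` as `t → 0⁺` (`c ≠ 0`).  PROOF ROUTE: `Tendsto.congr'` with E1 on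
`𝓝[>] 0`; `tendsto_finset_sum` and, termwise, `tendsto_siegelJacobiTheta_zPrime P hP hPp hD hd hN W` with the REAL matrix
`W = N⁻¹|c|⁻¹ ᵗL [T]` (`Matrix.map` bookkeeping: `W.map ofReal = …`; `hP`, `hPp` from `isSymm_of_level₅`/`posDef_map_of_level`
as in the tree's proof of `siegelThetaChi_eq_pow_mul_siegelGaussSum`); the value: `Σ_L e{[T][L]a/c} = |c|⁴ · siegelGaussSum [T] |c| (a/c)`
(`siegelGaussSum_def`, `4 * 1 = 4`), `(I c)^{−2} = −(c²)⁻¹` (`I_sq`), `√det([T]ℝ) = √((det[T] : ℤ) : ℝ)` (`Int.cast_det` /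
`RingHom.map_det`), `thetaCuspValue, if_neg hc`. -/
theorem tendsto_slash_brandtTheta_cuspPath [NeZero (Nplus * Nminus)] (i j : ClassSet S.O) (γ : SL(2, ℤ)) (hc : γ 1 0 ≠ 0) :
    Tendsto (fun t : ℝ => (⇑(S.brandtTheta i j) ∣[(2 : ℤ)] (γ : GL (Fin 2) ℝ)) (ModularGroup.S • UpperHalfPlane.ofComplex (I * t)))
      (𝓝[>] 0) (𝓝 (thetaCuspValue (brandtGram S i j) γ)) := by
  obtain ⟨P, hPQ, hQP, -⟩ := exists_brandtGram_levelDatum S i j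
  have hQ := brandtGram_isSymm S i j
  have hQp := posDef_brandtGram S i j
  set Q := brandtGram S i j with hQdef
  have hN : (0 : ℤ) < ((Nplus * Nminus : ℕ) : ℤ) := by exact_mod_cast Nat.pos_of_ne_zero (NeZero.ne (Nplus * Nminus))
  -- `P = N[T]⁻¹` is symmetric and positive
  have hP : P.IsSymm := by
    have h1 : Pᵀ * Q = P * Q := by
      rw [hPQ, ← hQ.eq, ← Matrix.transpose_mul, hQP, Matrix.transpose_smul, Matrix.transpose_one]
    have h2 : ((Nplus * Nminus : ℕ) : ℤ) • Pᵀ = ((Nplus * Nminus : ℕ) : ℤ) • P := by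
      calc ((Nplus * Nminus : ℕ) : ℤ) • Pᵀ = Pᵀ * (Q * P) := by rw [hQP, Matrix.mul_smul, Matrix.mul_one]
        _ = P * (Q * P) := by rw [← Matrix.mul_assoc, h1, Matrix.mul_assoc]
        _ = ((Nplus * Nminus : ℕ) : ℤ) • P := by rw [hQP, Matrix.mul_smul, Matrix.mul_one]
    refine Matrix.IsSymm.ext fun a b => mul_left_cancel₀ hN.ne' ?_
    have h := congr_fun (congr_fun h2 a) b
    simpa only [Matrix.smul_apply, Matrix.transpose_apply, smul_eq_mul] using h
  have hPp : (P.map ((↑) : ℤ → ℝ)).PosDef := posDef_map_of_level Q hQp hN hQP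
  have hD : (spOfSL (γ * ModularGroup.S)).toBlocks₂₂.det ≠ 0 := by
    rw [det_toBlocks₂₂_spOfSL_mul_S]; exact neg_ne_zero.2 hc
  have hd : 0 < (γ 1 0).natAbs := Int.natAbs_pos.2 hc
  -- termwise: every theta factor `Θ_P(Z′_t, W_L) → 1` (A–Z: "we can take the limit term by term … equal to 1")
  have hterm : ∀ L : Matrix (Fin 4) (Fin 1) (Fin (γ 1 0).natAbs),
      Tendsto (fun t : ℝ => siegelJacobiTheta P (0 : Matrix (Fin 1) (Fin 4) ℂ)
        ((((Nplus * Nminus : ℕ) : ℤ) : ℂ)⁻¹ • ((-((I * (t : ℂ))⁻¹ * ((((γ 1 0).natAbs : ℕ) : ℂ) ^ 2)⁻¹)) •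
          (SiegelUpperHalfSpace.denom ((spOfSL (γ * ModularGroup.S)).map ((↑) : ℤ → ℂ))
              ((I * (t : ℂ)) • (1 : Matrix (Fin 1) (Fin 1) ℂ)) *
            ((spOfSL (γ * ModularGroup.S)).toBlocks₂₂.map ((↑) : ℤ → ℂ))ᵀ)))
        ((((Nplus * Nminus : ℕ) : ℤ) : ℂ)⁻¹ •
          (((((γ 1 0).natAbs : ℕ) : ℂ))⁻¹ • ((L.map fun x => ((x : ℕ) : ℤ)).map ((↑) : ℤ → ℂ))ᵀ * Q.map ((↑) : ℤ → ℂ))))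
        (𝓝[>] 0) (𝓝 1) := by
    intro L
    have h := tendsto_siegelJacobiTheta_zPrime hP hPp hD hd hN
      ((((Nplus * Nminus : ℕ) : ℤ) : ℝ)⁻¹ •
        (((((γ 1 0).natAbs : ℕ) : ℝ))⁻¹ • ((L.map fun x => ((x : ℕ) : ℤ)).map ((↑) : ℤ → ℝ))ᵀ * Q.map ((↑) : ℤ → ℝ)))
    have hW : ((((Nplus * Nminus : ℕ) : ℤ) : ℝ)⁻¹ •
        (((((γ 1 0).natAbs : ℕ) : ℝ))⁻¹ • ((L.map fun x => ((x : ℕ) : ℤ)).map ((↑) : ℤ → ℝ))ᵀ * Q.map ((↑) : ℤ → ℝ))).map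
          ((↑) : ℝ → ℂ) =
        (((Nplus * Nminus : ℕ) : ℤ) : ℂ)⁻¹ •
          (((((γ 1 0).natAbs : ℕ) : ℂ))⁻¹ • ((L.map fun x => ((x : ℕ) : ℤ)).map ((↑) : ℤ → ℂ))ᵀ * Q.map ((↑) : ℤ → ℂ)) := by
      ext a b
      simp [Matrix.map_apply, Matrix.mul_apply, Matrix.smul_apply, Matrix.transpose_apply, Complex.ofReal_mul,
        Complex.ofReal_inv, Finset.mul_sum, -Nat.cast_natAbs]
    rw [hW] at h
    exact h
  -- E1 along the filter, the finite sum of limits, and the value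
  have hE : ∀ᶠ t : ℝ in 𝓝[>] 0, _ = _ :=
    eventually_nhdsWithin_of_forall fun t (ht : 0 < t) => slash_brandtTheta_apply_cuspPath S i j γ hc hPQ hQP ht
  have hsum := (tendsto_finsetSum Finset.univ fun L _ =>
    (hterm L).const_mul (siegelThetaSeriesTerm Q (one1 (((γ 0 0 : ℤ) : ℂ) / ((γ 1 0 : ℤ) : ℂ))) (L.map fun x => ((x : ℕ) : ℤ)))).const_mul
      (-((((Real.sqrt (Q.map ((↑) : ℤ → ℝ)).det : ℝ) : ℂ))⁻¹ * (((γ 1 0 : ℤ) : ℂ) ^ 2)⁻¹))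
  have hdet : ((Q.map ((↑) : ℤ → ℝ)).det : ℝ) = ((Q.det : ℤ) : ℝ) := by
    rw [show Q.map ((↑) : ℤ → ℝ) = (Int.castRingHom ℝ).mapMatrix Q from rfl, ← RingHom.map_det, eq_intCast]
  have hc0 : ((γ 1 0 : ℤ) : ℂ) ≠ 0 := by exact_mod_cast hc
  have hd0 : (((γ 1 0).natAbs : ℕ) : ℂ) ≠ 0 := by exact_mod_cast hd.ne'
  have hv : -((((Real.sqrt (Q.map ((↑) : ℤ → ℝ)).det : ℝ) : ℂ))⁻¹ * (((γ 1 0 : ℤ) : ℂ) ^ 2)⁻¹) *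
      ∑ L : Matrix (Fin 4) (Fin 1) (Fin (γ 1 0).natAbs),
        siegelThetaSeriesTerm Q (one1 (((γ 0 0 : ℤ) : ℂ) / ((γ 1 0 : ℤ) : ℂ))) (L.map fun x => ((x : ℕ) : ℤ)) * 1 =
      thetaCuspValue Q γ := by
    rw [thetaCuspValue, if_neg hc, siegelGaussSum_def, hdet]
    simp only [mul_one]
    rw [show (-((4 / 2 : ℕ) : ℤ)) = -(2 : ℤ) by norm_num, _root_.zpow_neg, zpow_ofNat, mul_pow, I_sq]
    field_simp
  rw [hv] at hsum
  exact hsum.congr' (hE.mono fun t ht => ht.symm)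

/-- Every `SL₂(ℤ)`-translate of `Θ_ij` tends to its `valueAtInfty` at `i∞` (tree `tendsto_cosetSlash`; as in gen-5 L1). PROVED. -/
theorem tendsto_slash_brandtTheta_atImInfty [NeZero (Nplus * Nminus)] (i j : ClassSet S.O) (γ : SL(2, ℤ)) :
    Tendsto (⇑(S.brandtTheta i j) ∣[(2 : ℤ)] (γ : GL (Fin 2) ℝ)) UpperHalfPlane.atImInfty
      (𝓝 (UpperHalfPlane.valueAtInfty (⇑(S.brandtTheta i j) ∣[(2 : ℤ)] (γ : GL (Fin 2) ℝ)))) := by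
  have := tendsto_cosetSlash (coe_mem_formSpace (S.brandtTheta i j))
    ((γ⁻¹ : SL(2, ℤ)) : SL(2, ℤ) ⧸ CongruenceSubgroup.Gamma0 (Nplus * Nminus))
  rwa [cosetSlash_mk (slash_eq_of_mem_gamma0Space (coe_mem_formSpace (S.brandtTheta i j))), inv_inv] at this

/-- **E1c (c = 0, PROVED).** At the cusp `∞` itself: `γ = ±T^h ∈ Γ₀(N)`, so `v(Θ_ij ∣₂ γ) = v(Θ_ij) = 1 = d²`. -/
theorem valueAtInfty_slash_brandtTheta_of_apply_eq_zero [NeZero (Nplus * Nminus)] (i j : ClassSet S.O) (γ : SL(2, ℤ))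
    (hc : γ 1 0 = 0) :
    UpperHalfPlane.valueAtInfty (⇑(S.brandtTheta i j) ∣[(2 : ℤ)] (γ : GL (Fin 2) ℝ)) = thetaCuspValue (brandtGram S i j) γ := by
  have hγ : γ ∈ CongruenceSubgroup.Gamma0 (Nplus * Nminus) := by
    rw [CongruenceSubgroup.Gamma0_mem, hc, Int.cast_zero]
  rw [slash_eq_of_mem_gamma0Space (coe_mem_formSpace (S.brandtTheta i j)) γ hγ, S.valueAtInfty_brandtTheta,
    thetaCuspValue, if_pos hc]
  have hdet := Matrix.det_fin_two (γ : Matrix (Fin 2) (Fin 2) ℤ)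
  rw [γ.det_coe, hc, mul_zero, sub_zero] at hdet
  rcases Int.eq_one_or_neg_one_of_mul_eq_one' hdet.symm with ⟨-, h⟩ | ⟨-, h⟩ <;> rw [h] <;> norm_num

/-- **E1′ (PROVED from E1b).** `valueAtInfty (Θ_ij ∣₂ γ) = thetaCuspValue [T_ij] γ` for every `γ ∈ SL₂(ℤ)`:
`c = 0` is E1c; `c ≠ 0` is uniqueness of limits along the path `S·(it) → i∞` between E1b and
`tendsto_slash_brandtTheta_atImInfty`. This is the E1′ the gen-6 composition `brandtTheta_sub_isCuspForm` consumes. -/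
theorem valueAtInfty_slash_brandtTheta [NeZero (Nplus * Nminus)] (i j : ClassSet S.O) (γ : SL(2, ℤ)) :
    UpperHalfPlane.valueAtInfty (⇑(S.brandtTheta i j) ∣[(2 : ℤ)] (γ : GL (Fin 2) ℝ)) = thetaCuspValue (brandtGram S i j) γ := by
  by_cases hc : γ 1 0 = 0
  · exact valueAtInfty_slash_brandtTheta_of_apply_eq_zero S i j γ hc
  · exact tendsto_nhds_unique ((tendsto_slash_brandtTheta_atImInfty S i j γ).comp tendsto_S_smul_ofComplex_I_mul)
      (tendsto_slash_brandtTheta_cuspPath S i j γ hc)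

/-! ## §F One cheap arithmetic helper of the gen-6 block: C3b (PROVED, gen 8) -/

/-- **C3b (gen 6, PROVED gen 8).** `G(a/c, Q)` depends only on `a mod c` for even symmetric `Q`: by
`siegelGaussSum_fin_one_eq_sum_stdAddChar` (A–Z (4.10), Prop. 4.9) it is `|c|^{-m} Σ_L ψ_{|c|}(a·sgn c·Q[L]/2)`, and
`a ≡ a' (mod |c|)` in `ZMod |c|` (`ZMod.intCast_eq_intCast_iff`). -/
theorem siegelGaussSum_congr_num {m : ℕ} {Q : Matrix (Fin m) (Fin m) ℤ} (hQ : Q.IsSymm) (hQe : ∀ i, Even (Q i i))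
    {a a' c : ℤ} (hc : c ≠ 0) (h : a ≡ a' [ZMOD c]) :
    siegelGaussSum Q c.natAbs (one1 ((a : ℂ) / (c : ℂ))) = siegelGaussSum Q c.natAbs (one1 ((a' : ℂ) / (c : ℂ))) := by
  haveI : NeZero c.natAbs := ⟨Int.natAbs_ne_zero.2 hc⟩
  have h' : a ≡ a' [ZMOD (c.natAbs : ℤ)] := Int.modEq_iff_dvd.2 (Int.natAbs_dvd.2 (Int.modEq_iff_dvd.1 h))
  show siegelGaussSum Q _ (Matrix.of fun _ _ : Fin 1 => _) = siegelGaussSum Q _ (Matrix.of fun _ _ : Fin 1 => _)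
  rw [siegelGaussSum_fin_one_eq_sum_stdAddChar Q hQ hQe rfl a, siegelGaussSum_fin_one_eq_sum_stdAddChar Q hQ hQe rfl a']
  congr 1
  refine Finset.sum_congr rfl fun L _ => ?_
  congr 1
  exact (ZMod.intCast_eq_intCast_iff _ _ _).2 ((h'.mul_right _).mul_right _)

/-! ## §G E2′ — the exact-conjugation case of the gen-6 helper E2 (the only case C4 uses; PROVED gen 8) -/

theorem map_mul_intCast {R : Type*} [NonAssocRing R] {a b c : Type*} [Fintype b] (A : Matrix a b ℤ) (B : Matrix b c ℤ) :
    (A * B).map ((↑) : ℤ → R) = A.map ((↑) : ℤ → R) * B.map ((↑) : ℤ → R) :=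
  Matrix.map_mul (f := Int.castRingHom R)

/-- `e{Q[U][L]·S} = e{Q[UL]·S}`. -/
theorem siegelThetaSeriesTerm_conj {m n : ℕ} (Q U : Matrix (Fin m) (Fin m) ℤ) (S' : Matrix (Fin n) (Fin n) ℂ)
    (L : Matrix (Fin m) (Fin n) ℤ) :
    siegelThetaSeriesTerm (Uᵀ * Q * U) S' L = siegelThetaSeriesTerm Q S' (U * L) := by
  rw [siegelThetaSeriesTerm_def, siegelThetaSeriesTerm_def, map_mul_intCast, map_mul_intCast, map_mul_intCast,
    Matrix.transpose_map, Matrix.transpose_mul]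
  simp only [Matrix.mul_assoc]

/-- **E2′ (gen 8, PROVED).** `G_d(S, Q[U]) = G_d(S, Q)` for `U` invertible modulo `d` (`UV ≡ 1 (mod d)`) and `dS` integral,
`S` symmetric: reindex `L ↦ UL` on `M_{m,n}(ℤ/d)`; the phase only sees `L mod d` (`siegelThetaSeriesTerm_add_smul`, A–Z (4.10)).
C4 uses it with `U, V` from B5 (`UᵀT_ijU = n·T_il`, `UV = n·1`, `n ⊥ c`, `V ↦ n̄V`), `d = |c|`, `S = (a/c)`, `T = (a·sgn c)`. -/
theorem siegelGaussSum_conj {m n : ℕ} {Q : Matrix (Fin m) (Fin m) ℤ} (hQ : Q.IsSymm) (hQe : ∀ i, Even (Q i i))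
    {S' : Matrix (Fin n) (Fin n) ℂ} (hS : S'.IsSymm) {d : ℕ} (hd : 0 < d) {T : Matrix (Fin n) (Fin n) ℤ}
    (hdS : (d : ℂ) • S' = T.map ((↑) : ℤ → ℂ)) {U V : Matrix (Fin m) (Fin m) ℤ}
    (hUV : ∀ r s, (d : ℤ) ∣ (U * V - 1) r s) :
    siegelGaussSum (Uᵀ * Q * U) d S' = siegelGaussSum Q d S' := by
  haveI : NeZero d := ⟨hd.ne'⟩
  -- `U`, `V` modulo `d` are mutually inverse
  set Ub : Matrix (Fin m) (Fin m) (ZMod d) := U.map ((↑) : ℤ → ZMod d) with hUb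
  set Vb : Matrix (Fin m) (Fin m) (ZMod d) := V.map ((↑) : ℤ → ZMod d) with hVb
  have hUVb : Ub * Vb = 1 := by
    rw [hUb, hVb, ← map_mul_intCast]
    ext r s
    have h := (ZMod.intCast_zmod_eq_zero_iff_dvd ((U * V - 1) r s) d).2 (hUV r s)
    rw [Matrix.sub_apply, Int.cast_sub, sub_eq_zero] at h
    rw [Matrix.map_apply, h, Matrix.one_apply, Matrix.one_apply]
    split_ifs <;> simp
  have hVUb : Vb * Ub = 1 := mul_eq_one_comm.1 hUVb
  -- `Fin d`-indexed sums as `ZMod d`-indexed sums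
  have hval : ∀ x : Fin d, ((ZMod.finEquiv d).toEquiv x).val = (x : ℕ) := by
    intro x
    obtain ⟨k, rfl⟩ : ∃ k, d = k + 1 := ⟨d - 1, (Nat.succ_pred_eq_of_pos hd).symm⟩
    rfl
  have hA : ∀ Q' : Matrix (Fin m) (Fin m) ℤ,
      ∑ L : Matrix (Fin m) (Fin n) (Fin d), siegelThetaSeriesTerm Q' S' (L.map fun x => ((x : ℕ) : ℤ)) =
        ∑ X : Matrix (Fin m) (Fin n) (ZMod d), siegelThetaSeriesTerm Q' S' (X.map fun x => ((x.val : ℕ) : ℤ)) := by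
    intro Q'
    refine Fintype.sum_equiv (ZMod.finEquiv d).toEquiv.mapMatrix _ _ fun L => ?_
    congr 1
    ext r s
    simp only [Equiv.mapMatrix_apply, Matrix.map_apply]
    exact (congrArg (fun t : ℕ => (t : ℤ)) (hval (L r s))).symm
  -- lift / reduce
  have hrl : ∀ X : Matrix (Fin m) (Fin n) (ZMod d), (X.map fun x => ((x.val : ℕ) : ℤ)).map ((↑) : ℤ → ZMod d) = X := by
    intro X; ext r s; simp [Matrix.map_apply]
  have hper : ∀ M : Matrix (Fin m) (Fin n) ℤ, siegelThetaSeriesTerm Q S' M =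
      siegelThetaSeriesTerm Q S' ((M.map ((↑) : ℤ → ZMod d)).map fun x => ((x.val : ℕ) : ℤ)) := by
    intro M
    have hM : M = ((M.map ((↑) : ℤ → ZMod d)).map fun x => ((x.val : ℕ) : ℤ)) + (d : ℤ) • M.map (fun z => z / (d : ℤ)) := by
      ext r s
      simp only [Matrix.add_apply, Matrix.map_apply, Matrix.smul_apply, smul_eq_mul, ZMod.val_intCast]
      rw [mul_comm]
      exact (Int.emod_add_ediv_mul _ _).symm
    have hdS' : (((d : ℕ) : ℤ) : ℂ) • S' = T.map ((↑) : ℤ → ℂ) := by rw [Int.cast_natCast]; exact hdS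
    conv_lhs => rw [hM]
    exact siegelThetaSeriesTerm_add_smul hQ hQe hS hdS' _ _
  have hredU : ∀ X : Matrix (Fin m) (Fin n) (ZMod d),
      (U * X.map fun x => ((x.val : ℕ) : ℤ)).map ((↑) : ℤ → ZMod d) = Ub * X := by
    intro X; rw [map_mul_intCast, hrl]
  let e : Matrix (Fin m) (Fin n) (ZMod d) ≃ Matrix (Fin m) (Fin n) (ZMod d) :=
    ⟨fun X => Ub * X, fun X => Vb * X, fun X => by simp only; rw [← Matrix.mul_assoc, hVUb, Matrix.one_mul],
      fun X => by simp only; rw [← Matrix.mul_assoc, hUVb, Matrix.one_mul]⟩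
  have he : ∀ X, e X = Ub * X := fun X => rfl
  have hsum : ∑ X : Matrix (Fin m) (Fin n) (ZMod d), siegelThetaSeriesTerm (Uᵀ * Q * U) S' (X.map fun x => ((x.val : ℕ) : ℤ)) =
      ∑ X : Matrix (Fin m) (Fin n) (ZMod d), siegelThetaSeriesTerm Q S' (X.map fun x => ((x.val : ℕ) : ℤ)) := by
    calc ∑ X : Matrix (Fin m) (Fin n) (ZMod d), siegelThetaSeriesTerm (Uᵀ * Q * U) S' (X.map fun x => ((x.val : ℕ) : ℤ))
        = ∑ X : Matrix (Fin m) (Fin n) (ZMod d), siegelThetaSeriesTerm Q S' ((e X).map fun x => ((x.val : ℕ) : ℤ)) := by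
          refine Finset.sum_congr rfl fun X _ => ?_
          rw [siegelThetaSeriesTerm_conj, hper (U * _), hredU, he]
      _ = ∑ X : Matrix (Fin m) (Fin n) (ZMod d), siegelThetaSeriesTerm Q S' (X.map fun x => ((x.val : ℕ) : ℤ)) :=
          Fintype.sum_equiv e _ _ fun X => rfl
  rw [siegelGaussSum_def, siegelGaussSum_def]
  exact congrArg (fun z => ((d : ℂ) ^ (m * n))⁻¹ * z) ((hA _).trans (hsum.trans (hA _).symm))

/-! ## §H C4 assembled from B5 and C1 (taken as HYPOTHESES) — the interface check (PROVED gen 8)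

With E2′, C3a, C3b and `det_brandtGram` in hand, the gen-6 assembly item C4 is a theorem modulo exactly B5 and C1,
whose gen-6 signatures are consumed VERBATIM below (so a prover closing B5 and C1 as typed closes C4, hence H1). -/

/-- **C3a (g6, proved there; copied).** `G_d(T, nQ) = G_d(nT, Q)`. -/
theorem siegelGaussSum_natCast_smul {m k : ℕ} (Q : Matrix (Fin m) (Fin m) ℤ) (n d : ℕ) (T : Matrix (Fin k) (Fin k) ℂ) :
    siegelGaussSum ((n : ℤ) • Q) d T = siegelGaussSum Q d ((n : ℂ) • T) := by
  simp only [siegelGaussSum]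
  refine congrArg₂ (· * ·) rfl (Finset.sum_congr rfl fun L _ => ?_)
  rw [siegelThetaSeriesTerm_def, siegelThetaSeriesTerm_def]
  have hmap : ((n : ℤ) • Q).map ((↑) : ℤ → ℂ) = (n : ℂ) • Q.map ((↑) : ℤ → ℂ) := by
    ext i j; simp only [Matrix.map_apply, Matrix.smul_apply, smul_eq_mul, Int.cast_mul, Int.cast_natCast]
  simp only [hmap, Matrix.mul_smul, Matrix.smul_mul]

/-- **C4 from B5 + C1 (gen 8, PROVED).** For `c = 0` take `γ' = γ`; for `c ≠ 0` take `n, U, V` from B5 at `|c|`, the matrix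
`γ' = (na, −v; c, u)` (`u·na + v·c = 1`), C1 for `γ' ∈ Γ₀(N)γT^ℤ`, and
`G(a/c,[T_ij]) = G(a/c,[T_ij][U])` (E2′ with `V' = n̄V`) `= G(a/c, n[T_il])` (B5) `= G(na/c,[T_il])` (C3a). -/
theorem exists_thetaCuspValue_brandtGram_eq_sameRow_of [NeZero (Nplus * Nminus)] (i j l : ClassSet S.O)
    (hB5 : ∀ c : ℕ, 0 < c → ∃ n : ℕ, n.Coprime c ∧ n ≡ 1 [MOD Nat.gcd c ((Nplus * Nminus) / Nat.gcd (Nplus * Nminus) c)] ∧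
      ∃ U V : Matrix (Fin 4) (Fin 4) ℤ,
        Uᵀ * brandtGram S i j * U = (n : ℤ) • brandtGram S i l ∧ U * V = (n : ℤ) • (1 : Matrix (Fin 4) (Fin 4) ℤ))
    (hC1 : ∀ γ γ' : SL(2, ℤ), γ 1 0 ≠ 0 → γ' 1 0 = γ 1 0 → ∀ n : ℤ, (γ 1 0 : ℤ) ∣ γ' 0 0 - n * γ 0 0 →
      ((Nat.gcd (γ 1 0).natAbs ((Nplus * Nminus) / Nat.gcd (Nplus * Nminus) (γ 1 0).natAbs) : ℕ) : ℤ) ∣ n - 1 →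
      ∃ δ ∈ CongruenceSubgroup.Gamma0 (Nplus * Nminus), ∃ h : ℤ, γ' = δ * γ * ModularGroup.T ^ h)
    (γ : SL(2, ℤ)) :
    ∃ γ' : SL(2, ℤ), (∃ δ ∈ CongruenceSubgroup.Gamma0 (Nplus * Nminus), ∃ h : ℤ, γ' = δ * γ * ModularGroup.T ^ h) ∧
      thetaCuspValue (brandtGram S i j) γ = thetaCuspValue (brandtGram S i l) γ' := by
  by_cases hc : γ 1 0 = 0
  · refine ⟨γ, ⟨1, one_mem _, 0, by simp⟩, ?_⟩
    rw [thetaCuspValue, thetaCuspValue, if_pos hc, if_pos hc]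
  -- data from B5 at `|c|`
  have hd : 0 < (γ 1 0).natAbs := Int.natAbs_pos.2 hc
  obtain ⟨n, hn, hng, U, V, hU, hUV⟩ := hB5 (γ 1 0).natAbs hd
  -- `γ' = (na, -v; c, u)`
  have hac : IsCoprime (γ 0 0 : ℤ) (γ 1 0) := by
    refine ⟨γ 1 1, -(γ 0 1), ?_⟩
    have hdet := γ.prop
    rw [Matrix.det_fin_two] at hdet
    linear_combination hdet
  have hnd : IsCoprime (n : ℤ) ((γ 1 0).natAbs : ℤ) := Nat.isCoprime_iff_coprime.2 hn
  have hnc : IsCoprime (n : ℤ) (γ 1 0) := by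
    rcases Int.natAbs_eq (γ 1 0) with h | h
    · rw [h]; exact hnd
    · rw [h]; exact hnd.neg_right
  obtain ⟨u, v, huv⟩ := hnc.mul_left hac
  let γ' : SL(2, ℤ) := ⟨!![(n : ℤ) * γ 0 0, -v; γ 1 0, u], by rw [Matrix.det_fin_two_of]; linear_combination huv⟩
  have h10 : γ' 1 0 = γ 1 0 := rfl
  have h00 : γ' 0 0 = n * γ 0 0 := rfl
  have hc' : γ' 1 0 ≠ 0 := by rw [h10]; exact hc
  -- C1
  have hg : ((Nat.gcd (γ 1 0).natAbs ((Nplus * Nminus) / Nat.gcd (Nplus * Nminus) (γ 1 0).natAbs) : ℕ) : ℤ) ∣ (n : ℤ) - 1 := by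
    have h := Nat.modEq_iff_dvd.1 hng.symm
    rwa [Nat.cast_one] at h
  obtain ⟨δ, hδ, h, hγ'⟩ := hC1 γ γ' hc h10 n (by rw [h00, sub_self]; exact dvd_zero _) hg
  refine ⟨γ', ⟨δ, hδ, h, hγ'⟩, ?_⟩
  -- the Gauss-sum chain
  have hQ := brandtGram_isSymm S i j
  have hQe := even_brandtGram_diag S i j
  have hS : (one1 (((γ 0 0 : ℤ) : ℂ) / ((γ 1 0 : ℤ) : ℂ))).IsSymm := SiegelModularForm.one1_transpose _
  have hc0 : ((γ 1 0 : ℤ) : ℂ) ≠ 0 := by exact_mod_cast hc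
  have hsc : (((γ 1 0).sign : ℤ) : ℂ) * ((γ 1 0 : ℤ) : ℂ) = (((γ 1 0).natAbs : ℕ) : ℂ) := by
    have h := congrArg (fun z : ℤ => (z : ℂ)) (Int.sign_mul_self_eq_natAbs (γ 1 0))
    simpa only [Int.cast_mul, Int.cast_natCast] using h
  have hdS : (((γ 1 0).natAbs : ℕ) : ℂ) • one1 (((γ 0 0 : ℤ) : ℂ) / ((γ 1 0 : ℤ) : ℂ)) =
      (one1 (γ 0 0 * (γ 1 0).sign)).map ((↑) : ℤ → ℂ) := by
    rw [one1_map, smul_one1]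
    congr 1
    field_simp
    push_cast
    linear_combination (-((γ 0 0 : ℤ) : ℂ)) * hsc
  obtain ⟨nb, w, hnb⟩ := hnd
  have hUV' : ∀ r s, (((γ 1 0).natAbs : ℕ) : ℤ) ∣ (U * (nb • V) - 1) r s := by
    intro r s
    rw [Matrix.mul_smul, hUV, smul_smul, Matrix.sub_apply, Matrix.smul_apply, Matrix.one_apply]
    split_ifs
    · exact ⟨-w, by rw [smul_eq_mul, mul_one]; linear_combination hnb⟩
    · simp
  have hG : siegelGaussSum (brandtGram S i j) (γ 1 0).natAbs (one1 (((γ 0 0 : ℤ) : ℂ) / ((γ 1 0 : ℤ) : ℂ))) =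
      siegelGaussSum (brandtGram S i l) (γ 1 0).natAbs (one1 ((((n : ℤ) * γ 0 0 : ℤ) : ℂ) / ((γ 1 0 : ℤ) : ℂ))) := by
    rw [← siegelGaussSum_conj hQ hQe hS hd hdS hUV', hU, siegelGaussSum_natCast_smul, smul_one1]
    congr 2
    push_cast
    ring
  rw [thetaCuspValue, thetaCuspValue, if_neg hc, if_neg hc', det_brandtGram, det_brandtGram, h10, h00, hG]

/-! ## §I H1 modulo exactly {B5, C1} — the gen-6 §D composition re-run on the gen-8 proofs (kernel-checked, 0 sorries)

`B5Statement` / `C1Statement` are the gen-6 signatures of B5 (`exists_brandtGram_sublattice_datum`, with `hN`/`hcop` moved to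
where a prover has them) and C1 (`exists_gamma0_mul_T_zpow`) as `Prop`s; L1 and C2 are the gen-5/6 proofs repeated verbatim. -/

/-- B5 (gen-6 signature) as a hypothesis. -/
def B5Statement (i j l : ClassSet S.O) : Prop :=
  ∀ c : ℕ, 0 < c → ∃ n : ℕ, n.Coprime c ∧ n ≡ 1 [MOD Nat.gcd c ((Nplus * Nminus) / Nat.gcd (Nplus * Nminus) c)] ∧
    ∃ U V : Matrix (Fin 4) (Fin 4) ℤ,
      Uᵀ * brandtGram S i j * U = (n : ℤ) • brandtGram S i l ∧ U * V = (n : ℤ) • (1 : Matrix (Fin 4) (Fin 4) ℤ)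

/-- C1 (gen-6 signature) as a hypothesis. -/
def C1Statement (N : ℕ) : Prop :=
  ∀ γ γ' : SL(2, ℤ), γ 1 0 ≠ 0 → γ' 1 0 = γ 1 0 → ∀ n : ℤ, (γ 1 0 : ℤ) ∣ γ' 0 0 - n * γ 0 0 →
    ((Nat.gcd (γ 1 0).natAbs (N / Nat.gcd N (γ 1 0).natAbs) : ℕ) : ℤ) ∣ n - 1 →
    ∃ δ ∈ CongruenceSubgroup.Gamma0 N, ∃ h : ℤ, γ' = δ * γ * ModularGroup.T ^ h

/-- **L1 (gen 5, PROVED there; repeated).** Equal values of all `SL₂(ℤ)`-translates ⇒ the difference is cuspidal. -/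
theorem isCuspForm_sub_of_forall_valueAtInfty_slash_eq {N : ℕ} [NeZero N] (f g : ModularForm (CongruenceSubgroup.Gamma0 N) 2)
    (h : ∀ γ : SL(2, ℤ), UpperHalfPlane.valueAtInfty (⇑f ∣[(2 : ℤ)] (γ : GL (Fin 2) ℝ)) =
      UpperHalfPlane.valueAtInfty (⇑g ∣[(2 : ℤ)] (γ : GL (Fin 2) ℝ))) :
    ModularForm.IsCuspForm (f - g) := by
  have hF : (⇑f - ⇑g) ∈ gamma0Space N 2 := Submodule.sub_mem _ (coe_mem_formSpace f) (coe_mem_formSpace g)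
  have hlim : ∀ (u : ModularForm (CongruenceSubgroup.Gamma0 N) 2) (γ : SL(2, ℤ)),
      Tendsto (⇑u ∣[(2 : ℤ)] (γ : GL (Fin 2) ℝ)) UpperHalfPlane.atImInfty
        (𝓝 (UpperHalfPlane.valueAtInfty (⇑u ∣[(2 : ℤ)] (γ : GL (Fin 2) ℝ)))) := by
    intro u γ
    have := tendsto_cosetSlash (coe_mem_formSpace u) ((γ⁻¹ : SL(2, ℤ)) : SL(2, ℤ) ⧸ CongruenceSubgroup.Gamma0 N)
    rwa [cosetSlash_mk (slash_eq_of_mem_gamma0Space (coe_mem_formSpace u)), inv_inv] at this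
  have h0 : ∀ γ : SL(2, ℤ), UpperHalfPlane.IsZeroAtImInfty ((⇑f - ⇑g) ∣[(2 : ℤ)] (γ : GL (Fin 2) ℝ)) := by
    intro γ
    have hsub : (⇑f - ⇑g) ∣[(2 : ℤ)] (γ : GL (Fin 2) ℝ) =
        ⇑f ∣[(2 : ℤ)] (γ : GL (Fin 2) ℝ) - ⇑g ∣[(2 : ℤ)] (γ : GL (Fin 2) ℝ) := by
      rw [sub_eq_add_neg, SlashAction.add_slash, SlashAction.neg_slash, ← sub_eq_add_neg]
    show Tendsto ((⇑f - ⇑g) ∣[(2 : ℤ)] (γ : GL (Fin 2) ℝ)) UpperHalfPlane.atImInfty (𝓝 0)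
    rw [hsub]
    have := (hlim f γ).sub (hlim g γ)
    rwa [h γ, sub_self] at this
  refine ⟨cuspFormOfVanishing (⇑f - ⇑g) hF h0, ?_⟩
  ext τ
  rw [CuspForm.toModularFormₗ_apply, ModularForm.sub_apply]
  rfl

/-- **C2 (gen 6, PROVED there; repeated).** `v(f ∣ δ γ T^h) = v(f ∣ γ)` for `δ ∈ Γ₀(N)`. -/
theorem valueAtInfty_slash_gamma0_mul_T_zpow {N : ℕ} [NeZero N] {k : ℤ} (f : ModularForm (CongruenceSubgroup.Gamma0 N) k)
    (γ : SL(2, ℤ)) {δ : SL(2, ℤ)} (hδ : δ ∈ CongruenceSubgroup.Gamma0 N) (h : ℤ) :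
    UpperHalfPlane.valueAtInfty (⇑f ∣[k] ((δ * γ * ModularGroup.T ^ h : SL(2, ℤ)) : GL (Fin 2) ℝ)) =
      UpperHalfPlane.valueAtInfty (⇑f ∣[k] (γ : GL (Fin 2) ℝ)) := by
  have hγ : ⇑f ∣[k] ((δ * γ * ModularGroup.T ^ h : SL(2, ℤ)) : GL (Fin 2) ℝ) =
      transl h (⇑f ∣[k] (γ : GL (Fin 2) ℝ)) := by
    rw [coeGL_mul, coeGL_mul, SlashAction.slash_mul, SlashAction.slash_mul,
      slash_eq_of_mem_gamma0Space (coe_mem_formSpace f) δ hδ, slash_T_zpow_eq_transl]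
  have hlim : Tendsto (⇑f ∣[k] (γ : GL (Fin 2) ℝ)) UpperHalfPlane.atImInfty
      (𝓝 (UpperHalfPlane.valueAtInfty (⇑f ∣[k] (γ : GL (Fin 2) ℝ)))) := by
    have := tendsto_cosetSlash (coe_mem_formSpace f) ((γ⁻¹ : SL(2, ℤ)) : SL(2, ℤ) ⧸ CongruenceSubgroup.Gamma0 N)
    rwa [cosetSlash_mk (slash_eq_of_mem_gamma0Space (coe_mem_formSpace f)), inv_inv] at this
  rw [hγ]
  exact (hlim.comp (tendsto_T_zpow_smul_atImInfty h)).limUnder_eq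

/-- **H1, same row, modulo {B5, C1}.** -/
theorem brandtTheta_sub_isCuspForm_sameRow_of [NeZero (Nplus * Nminus)] (i j l : ClassSet S.O)
    (hB5 : B5Statement S i j l) (hC1 : C1Statement (Nplus * Nminus)) :
    ModularForm.IsCuspForm (S.brandtTheta i j - S.brandtTheta i l) := by
  refine isCuspForm_sub_of_forall_valueAtInfty_slash_eq _ _ fun γ => ?_
  obtain ⟨γ', ⟨δ, hδ, h, rfl⟩, hv⟩ := exists_thetaCuspValue_brandtGram_eq_sameRow_of S i j l hB5 hC1 γ
  rw [valueAtInfty_slash_brandtTheta S i j γ, hv, ← valueAtInfty_slash_brandtTheta S i l,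
    valueAtInfty_slash_gamma0_mul_T_zpow (S.brandtTheta i l) γ hδ h]

/-- **H1 exactly as consumed by k2's closing chain, modulo {B5 (all same-row triples), C1}.** -/
theorem brandtTheta_sub_isCuspForm_of [NeZero (Nplus * Nminus)]
    (hB5 : ∀ i j l : ClassSet S.O, B5Statement S i j l) (hC1 : C1Statement (Nplus * Nminus))
    (i j k l : ClassSet S.O) : ModularForm.IsCuspForm (S.brandtTheta i j - S.brandtTheta k l) := by
  have h1 := brandtTheta_sub_isCuspForm_sameRow_of S i j l (hB5 i j l) hC1
  have h2 := brandtTheta_sub_isCuspForm_sameRow_of S l i k (hB5 l i k) hC1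
  rw [S.brandtTheta_symm l i, S.brandtTheta_symm l k] at h2
  have h3 : S.brandtTheta i j - S.brandtTheta k l =
      (S.brandtTheta i j - S.brandtTheta i l) + (S.brandtTheta i l - S.brandtTheta k l) := by
    abel
  rw [ModularForm.IsCuspForm, h3]
  exact Submodule.add_mem _ h1 h2

/-! ## §J C1 PROVED (gen 8): `Γ₀(N)`-double-coset recognition `γ' ∈ Γ₀(N) γ T^ℤ`

`δ_h := γ' T^{-h} γ⁻¹` has lower-left entry `c (d − d' + h c)`; with `G = (N, c)`, `M = N/G`, `g = (c, M)`:
`g ∣ a' − a` (from `c ∣ a' − n a`, `g ∣ n − 1`), hence `g ∣ d − d' = d d'(a' − a) + c (b d' − b' d)`; Bézout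
`g = |c| x + M y` gives `h` with `M ∣ d − d' + h c`, and then `N = G M ∣ c (d − d' + h c)`. -/
theorem c1Statement_holds (N : ℕ) [NeZero N] : C1Statement N := by
  intro γ γ' hc hcc n hn hg
  have hdet : γ 0 0 * γ 1 1 - γ 0 1 * γ 1 0 = 1 := by
    have h := γ.prop; rw [Matrix.det_fin_two] at h; exact h
  have hdet' : γ' 0 0 * γ' 1 1 - γ' 0 1 * γ 1 0 = 1 := by
    have h := γ'.prop; rw [Matrix.det_fin_two, hcc] at h; exact h
  -- moduli
  set G : ℕ := Nat.gcd N (γ 1 0).natAbs with hG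
  set M : ℕ := N / G with hM
  set g : ℕ := Nat.gcd (γ 1 0).natAbs M with hg'
  have hgc : (g : ℤ) ∣ γ 1 0 := (Int.natCast_dvd_natCast.2 (Nat.gcd_dvd_left _ _)).trans (Int.natAbs_dvd.2 dvd_rfl)
  have hGc : (G : ℤ) ∣ γ 1 0 := (Int.natCast_dvd_natCast.2 (Nat.gcd_dvd_right _ _)).trans (Int.natAbs_dvd.2 dvd_rfl)
  have hNM : (N : ℤ) = G * M := by rw [hM]; exact_mod_cast (Nat.mul_div_cancel' (Nat.gcd_dvd_left _ _)).symm
  -- `g ∣ d - d'`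
  have h1 : (g : ℤ) ∣ γ' 0 0 - γ 0 0 := by
    have : (γ' 0 0 : ℤ) - γ 0 0 = (γ' 0 0 - n * γ 0 0) + (n - 1) * γ 0 0 := by ring
    rw [this]; exact dvd_add (hgc.trans hn) (hg.mul_right _)
  have hdd : (g : ℤ) ∣ γ 1 1 - γ' 1 1 := by
    have : (γ 1 1 : ℤ) - γ' 1 1 = γ 1 1 * γ' 1 1 * (γ' 0 0 - γ 0 0) + γ 1 0 * (γ 0 1 * γ' 1 1 - γ' 0 1 * γ 1 1) := by
      linear_combination γ' 1 1 * hdet - γ 1 1 * hdet'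
    rw [this]; exact dvd_add (h1.mul_left _) (hgc.mul_right _)
  obtain ⟨t, ht⟩ := hdd
  -- Bézout and the shift
  have hbez : (g : ℤ) = ((γ 1 0).natAbs : ℤ) * Nat.gcdA (γ 1 0).natAbs M + (M : ℤ) * Nat.gcdB (γ 1 0).natAbs M :=
    Nat.gcd_eq_gcd_ab _ _
  have habs : (((γ 1 0).natAbs : ℕ) : ℤ) = (γ 1 0).sign * γ 1 0 := (Int.sign_mul_self_eq_natAbs _).symm
  set x : ℤ := Nat.gcdA (γ 1 0).natAbs M with hx
  set y : ℤ := Nat.gcdB (γ 1 0).natAbs M with hy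
  set h : ℤ := -((γ 1 0).sign * x * t) with hh
  have hMdvd : (M : ℤ) ∣ γ 1 1 - γ' 1 1 + h * γ 1 0 :=
    ⟨t * y, by rw [ht, hh]; linear_combination t * hbez + x * t * habs⟩
  refine ⟨γ' * (ModularGroup.T ^ h)⁻¹ * γ⁻¹, ?_, h, by group⟩
  have hentry : ((γ' * (ModularGroup.T ^ h)⁻¹ * γ⁻¹ : SL(2, ℤ)) : Matrix (Fin 2) (Fin 2) ℤ) 1 0 =
      γ 1 0 * (γ 1 1 - γ' 1 1 + h * γ 1 0) := by
    rw [← _root_.zpow_neg, Matrix.SpecialLinearGroup.coe_mul, Matrix.SpecialLinearGroup.coe_mul, ModularGroup.coe_T_zpow,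
      Matrix.SpecialLinearGroup.coe_inv, Matrix.adjugate_fin_two]
    simp [Matrix.mul_apply, Fin.sum_univ_two]
    rw [hcc]; ring
  rw [CongruenceSubgroup.Gamma0_mem, hentry, ZMod.intCast_zmod_eq_zero_iff_dvd]
  obtain ⟨k, hk⟩ := hMdvd
  obtain ⟨c₁, hc₁⟩ := hGc
  refine ⟨c₁ * k, ?_⟩
  rw [hk, hNM, hc₁]; ring

/-- **C1 in the gen-6 signature.** -/
theorem exists_gamma0_mul_T_zpow {N : ℕ} [NeZero N] (γ γ' : SL(2, ℤ)) (hc : γ 1 0 ≠ 0) (hcc : γ' 1 0 = γ 1 0) {n : ℤ}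
    (hn : (γ 1 0 : ℤ) ∣ γ' 0 0 - n * γ 0 0)
    (hg : ((Nat.gcd (γ 1 0).natAbs (N / Nat.gcd N (γ 1 0).natAbs) : ℕ) : ℤ) ∣ n - 1) :
    ∃ δ ∈ CongruenceSubgroup.Gamma0 N, ∃ h : ℤ, γ' = δ * γ * ModularGroup.T ^ h :=
  c1Statement_holds N γ γ' hc hcc n hn hg

/-- **H1 modulo B5 alone (gen 8).** -/
theorem brandtTheta_sub_isCuspForm_of_B5 [NeZero (Nplus * Nminus)]
    (hB5 : ∀ i j l : ClassSet S.O, B5Statement S i j l)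
    (i j k l : ClassSet S.O) : ModularForm.IsCuspForm (S.brandtTheta i j - S.brandtTheta k l) :=
  brandtTheta_sub_isCuspForm_of S hB5 (c1Statement_holds _) i j k l

end Summit.ABC.ABC.Cruxes.SteinbergCore.StubIdeasK1G8
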